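import Summits.Ventures.AbcSig.Conjectures.LevelRaising128Hasse
import Summits.Ventures.AbcSig.Recipes.KrausTable

/-!
# Venture AbcSig — SEMANTICS of the Kraus-table generator: `legendreNaive` is the Legendre symbol, `traceNaive` is the trace

HONEST FRAMING. Support file of the computation cell `pub-abcsig`; unconditional arithmetic facts about the computable functions of
`Recipes/KrausTable.lean` (the Lean transcription of the referee's `refallowed.py`). No Diophantine statement, no hypothesis, no claim
on ABC or any summit. It does NOT prove that the tables contain the traces of the Frey curves of actual solutions (that remains the
cited half of `RefinedTraces`); it proves that what the generator computes per curve IS the trace of Frobenius of that curve.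

WHAT IS PROVED (for an odd prime `q`).
* `legendreNaive_eq_quadraticChar` — the Euler-criterion function `legendreNaive q v` equals Mathlib's quadratic character
  `quadraticChar (ZMod q) v` (hence the Legendre symbol `legendreSym q v`).
* `nsqCubic_eq_quadraticChar_add_one` — the cell's fibre count `#{y : y² ≡ w}` is `χ(w) + 1` (Mathlib's `quadraticChar_card_sqrts`).
* `traceNaive_eq_apCubic` — the generator's `traceNaive q a₂ a₄ = −Σ_x χ(x³ + a₂x² + a₄x)` equals the naive point-count trace
  `apCubic q a₂ a₄ 0` of `Conjectures/LevelRaising128.lean`.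
* `traceNaive_eq_trace` — hence, when `Y² = X³ + a₂X² + a₄X` is elliptic over `ZMod q`, `traceNaive q a₂ a₄ = q + 1 − #E(ZMod q)`
  (Mathlib's points with the point at infinity; via `apCubic_eq_trace` of `Conjectures/LevelRaising128Hasse.lean`).
* `two_dvd_natCard_of_a₆_zero`, `traceNaive_even`, `traceNaive_sq_le`, `traceNaive_mem_bs04Allowed` — every such trace is even (the
  point `(0, 0)` has order `2`) and satisfies Hasse's bound (`q ≠ 3`; the tree's Manin/Knapp proof), so lies in [BS04, Lemma 4.2]'s
  coarse list: the entries the generator produces from nonsingular curves can only REFINE `bs04Allowed q`.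

References: [BS04] Bennett–Skinner, Canad. J. Math. 56 (2004), p. 27, Lemma 4.2; A. W. Knapp, *Elliptic Curves* (1992) §X.3 (the
tree's `HasseElementary`); cell records HOME/referee/refallowed.py (the functions `legendre_table`, `trace_short`).
-/

namespace Summit.Ventures.AbcSig.Conjectures

open Summit.Ventures.AbcSig

/-- **Euler's criterion, computably**: `legendreNaive q v = χ_q(v)` for an odd prime `q`. -/
theorem legendreNaive_eq_quadraticChar {q : ℕ} [Fact q.Prime] (hq2 : q ≠ 2) (v : ℕ) :
    legendreNaive q v = quadraticChar (ZMod q) (v : ZMod q) := by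
  have hq := (Fact.out : q.Prime)
  have hchar : ringChar (ZMod q) ≠ 2 := by rw [ZMod.ringChar_zmod_n]; exact hq2
  unfold legendreNaive
  by_cases h0 : v % q = 0
  · rw [if_pos h0]
    have hv : (v : ZMod q) = 0 := (ZMod.natCast_eq_zero_iff v q).mpr (Nat.dvd_of_mod_eq_zero h0)
    rw [hv, MulChar.map_zero]
  · rw [if_neg h0]
    have hv : (v : ZMod q) ≠ 0 := fun h => h0 (Nat.mod_eq_zero_of_dvd ((ZMod.natCast_eq_zero_iff v q).mp h))
    rw [quadraticChar_eq_pow_of_char_ne_two hchar hv, ZMod.card]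
    have hq_odd : q % 2 = 1 := Nat.odd_iff.mp (hq.odd_of_ne_two hq2)
    have hhalf : q / 2 = (q - 1) / 2 := by omega
    have hiff : (v : ZMod q) ^ (q / 2) = 1 ↔ v ^ ((q - 1) / 2) % q = 1 := by
      have h1 : ((v ^ ((q - 1) / 2) : ℕ) : ZMod q) = ((1 : ℕ) : ZMod q) ↔ v ^ ((q - 1) / 2) % q = 1 % q :=
        ZMod.natCast_eq_natCast_iff' _ _ _
      rw [Nat.cast_pow, Nat.cast_one, Nat.mod_eq_of_lt hq.one_lt] at h1
      rw [hhalf]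
      exact h1
    by_cases h1 : v ^ ((q - 1) / 2) % q = 1
    · rw [if_pos h1, if_pos (hiff.mpr h1)]
    · rw [if_neg h1, if_neg (fun h => h1 (hiff.mp h))]

/-- `legendreNaive` is the Legendre symbol. -/
theorem legendreNaive_eq_legendreSym {q : ℕ} [Fact q.Prime] (hq2 : q ≠ 2) (v : ℕ) :
    legendreNaive q v = legendreSym q v := by
  rw [legendreNaive_eq_quadraticChar hq2, legendreSym, Int.cast_natCast]

/-- The defining congruence of `nsqCubic`, read in `ZMod q`. -/
private theorem nsq_congr_iff'' {q : ℕ} [Fact q.Prime] (w y : ℕ) :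
    (y * y) % q = w % q ↔ ((y : ZMod q)) ^ 2 = (w : ZMod q) := by
  rw [← ZMod.natCast_eq_natCast_iff']
  push_cast
  constructor <;> intro h <;> linear_combination h

/-- **The fibre count is `χ + 1`**: `nsqCubic q c₂ c₁ c₀ x = χ_q(x³ + c₂x² + c₁x + c₀) + 1` for an odd prime `q`. -/
theorem nsqCubic_eq_quadraticChar_add_one {q : ℕ} [Fact q.Prime] (hq2 : q ≠ 2) (c₂ c₁ c₀ x : ℕ) :
    (nsqCubic q c₂ c₁ c₀ x : ℤ) = quadraticChar (ZMod q) ((x ^ 3 + c₂ * x ^ 2 + c₁ * x + c₀ : ℕ) : ZMod q) + 1 := by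
  classical
  have hchar : ringChar (ZMod q) ≠ 2 := by rw [ZMod.ringChar_zmod_n]; exact hq2
  set w : ℕ := x ^ 3 + c₂ * x ^ 2 + c₁ * x + c₀ with hw
  rw [← quadraticChar_card_sqrts hchar, Set.toFinset_setOf]
  norm_cast
  unfold nsqCubic
  refine Finset.card_bij (fun y _ => (y : ZMod q)) ?_ ?_ ?_
  · intro y hy
    simp only [Finset.mem_filter, Finset.mem_range, Finset.mem_univ, true_and] at hy ⊢
    exact (nsq_congr_iff'' w y).mp hy.2
  · intro y₁ hy₁ y₂ hy₂ h
    simp only [Finset.mem_filter, Finset.mem_range] at hy₁ hy₂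
    have h' := (ZMod.natCast_eq_natCast_iff' y₁ y₂ q).mp h
    rwa [Nat.mod_eq_of_lt hy₁.1, Nat.mod_eq_of_lt hy₂.1] at h'
  · intro z hz
    simp only [Finset.mem_filter, Finset.mem_univ, true_and] at hz
    refine ⟨z.val, ?_, ZMod.natCast_zmod_val z⟩
    simp only [Finset.mem_filter, Finset.mem_range]
    refine ⟨ZMod.val_lt z, (nsq_congr_iff'' w z.val).mpr ?_⟩
    rw [ZMod.natCast_zmod_val]
    exact hz

/-- `Σ_{x ∈ range q} f x = ((List.range q).map f).sum`. -/
private theorem sum_range_eq_list_sum (q : ℕ) (f : ℕ → ℤ) :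
    ∑ x ∈ Finset.range q, f x = ((List.range q).map f).sum := by
  rw [Finset.sum_eq_multiset_sum, Finset.range_val, ← Multiset.coe_range, Multiset.map_coe, Multiset.sum_coe]

/-- **The generator's trace is the naive point-count trace**: `traceNaive q a₂ a₄ = apCubic q a₂ a₄ 0` for an odd prime `q`. -/
theorem traceNaive_eq_apCubic {q : ℕ} [Fact q.Prime] (hq2 : q ≠ 2) (a₂ a₄ : ℕ) :
    traceNaive q a₂ a₄ = apCubic q a₂ a₄ 0 := by
  unfold traceNaive apCubic
  have hpt : ∀ x : ℕ, (nsqCubic q a₂ a₄ 0 x : ℤ) = legendreNaive q (x ^ 3 + a₂ * x ^ 2 + a₄ * x) + 1 := by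
    intro x
    rw [nsqCubic_eq_quadraticChar_add_one hq2, legendreNaive_eq_quadraticChar hq2, Nat.add_zero]
  rw [Finset.sum_congr rfl fun x _ => hpt x, Finset.sum_add_distrib, Finset.sum_const, Finset.card_range,
    nsmul_eq_mul, mul_one, sum_range_eq_list_sum]
  ring

/-- **The generator's trace is the trace of Frobenius**: for an odd prime `q` and `E : Y² = X³ + a₂X² + a₄X` elliptic over `ZMod q`,
`traceNaive q a₂ a₄ = q + 1 − #E(ZMod q)`. -/
theorem traceNaive_eq_trace {q : ℕ} [Fact q.Prime] (hq2 : q ≠ 2) (a₂ a₄ : ℕ) (E : WeierstrassCurve (ZMod q)) [E.IsElliptic]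
    (h₁ : E.a₁ = 0) (h₂ : E.a₂ = a₂) (h₃ : E.a₃ = 0) (h₄ : E.a₄ = a₄) (h₆ : E.a₆ = 0) :
    traceNaive q a₂ a₄ = (q : ℤ) + 1 - (Nat.card E.toAffine.Point : ℤ) := by
  rw [traceNaive_eq_apCubic hq2]
  exact apCubic_eq_trace hq2 a₂ a₄ 0 E h₁ h₃ h₂ h₄ (by rw [h₆, Nat.cast_zero])

/-- A curve `Y² = X³ + a₂X² + a₄X` (i.e. `a₁ = a₃ = a₆ = 0`) elliptic over a field with `2 ≠ 0` has an even number of points: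
`(0, 0)` is a rational point of order `2`. -/
theorem two_dvd_natCard_of_a₆_zero {F : Type*} [Field F] [DecidableEq F] (E : WeierstrassCurve F) [E.IsElliptic]
    (h₁ : E.a₁ = 0) (h₃ : E.a₃ = 0) (h₆ : E.a₆ = 0) : 2 ∣ Nat.card E.toAffine.Point := by
  have heq : E.toAffine.Equation 0 0 := by
    rw [WeierstrassCurve.Affine.equation_iff, h₆]
    ring
  set P : E.toAffine.Point := .some 0 0 ((WeierstrassCurve.Affine.equation_iff_nonsingular).mp heq) with hP
  have hneg : -P = P := by
    rw [hP, WeierstrassCurve.Affine.Point.neg_some]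
    congr 1
    rw [WeierstrassCurve.Affine.negY, h₁, h₃]
    ring
  have h2P : 2 • P = 0 := by
    rw [two_nsmul]
    nth_rewrite 1 [← hneg]
    exact neg_add_cancel P
  rw [← addOrderOf_eq_prime h2P (WeierstrassCurve.Affine.Point.some_ne_zero _)]
  exact addOrderOf_dvd_natCard P

/-- Every trace the generator computes from an ELLIPTIC curve `Y² = X³ + a₂X² + a₄X` over `ZMod q` (`q` an odd prime) is even. -/
theorem traceNaive_even {q : ℕ} [Fact q.Prime] (hq2 : q ≠ 2) (a₂ a₄ : ℕ) (E : WeierstrassCurve (ZMod q)) [E.IsElliptic]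
    (h₁ : E.a₁ = 0) (h₂ : E.a₂ = a₂) (h₃ : E.a₃ = 0) (h₄ : E.a₄ = a₄) (h₆ : E.a₆ = 0) :
    traceNaive q a₂ a₄ % 2 = 0 := by
  have ht := traceNaive_eq_trace hq2 a₂ a₄ E h₁ h₂ h₃ h₄ h₆
  obtain ⟨m, hm⟩ := two_dvd_natCard_of_a₆_zero E h₁ h₃ h₆
  have hq_odd : q % 2 = 1 := Nat.odd_iff.mp ((Fact.out : q.Prime).odd_of_ne_two hq2)
  rw [hm] at ht
  push_cast at ht
  omega

/-- … and satisfies Hasse's bound `t² ≤ 4q` (`q ≠ 3`; the tree's elementary Hasse theorem). -/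
theorem traceNaive_sq_le {q : ℕ} [Fact q.Prime] (hq2 : q ≠ 2) (hq3 : q ≠ 3) (a₂ a₄ : ℕ) (E : WeierstrassCurve (ZMod q))
    [E.IsElliptic] (h₁ : E.a₁ = 0) (h₂ : E.a₂ = a₂) (h₃ : E.a₃ = 0) (h₄ : E.a₄ = a₄) (h₆ : E.a₆ = 0) :
    traceNaive q a₂ a₄ * traceNaive q a₂ a₄ ≤ 4 * (q : ℤ) := by
  rw [traceNaive_eq_trace hq2 a₂ a₄ E h₁ h₂ h₃ h₄ h₆, ← sq]
  exact trace_sq_le_of_ringChar_ne hq2 hq3 E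

/-- … hence lies in [BS04, Lemma 4.2]'s coarse list `bs04Allowed q`: the generator's entries REFINE the generic set. -/
theorem traceNaive_mem_bs04Allowed {q : ℕ} [Fact q.Prime] (hq2 : q ≠ 2) (hq3 : q ≠ 3) (a₂ a₄ : ℕ)
    (E : WeierstrassCurve (ZMod q)) [E.IsElliptic] (h₁ : E.a₁ = 0) (h₂ : E.a₂ = a₂) (h₃ : E.a₃ = 0) (h₄ : E.a₄ = a₄)
    (h₆ : E.a₆ = 0) : traceNaive q a₂ a₄ ∈ bs04Allowed q :=
  (mem_bs04Allowed_iff q _).mpr (Or.inl ⟨traceNaive_even hq2 a₂ a₄ E h₁ h₂ h₃ h₄ h₆,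
    traceNaive_sq_le hq2 hq3 a₂ a₄ E h₁ h₂ h₃ h₄ h₆⟩)

end Summit.Ventures.AbcSig.Conjectures
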